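import Summits.AtomisticToContinuum.BoseEinsteinCondensation.Theses.BECInfraredBound
import Literature.MathematicalPhysics.QuantumManyBody.BoseGasDirichletWall

/-!
# Negative lemmas for crux `BecDepletionSplit` (stmt-AtomisticToContinuum-9026): load-bearing
hypotheses of the occupation-generic skeleton, the item text's threshold recipe, tightness

Supports (does not close) stmt-AtomisticToContinuum-9026, route `BECInfraredBound` (glue piece 2/3:
window count + UV tail ⇒ inner-box depletion `Σ'_{k≠0} ⟨φ'_k, γ_Ψ φ'_k⟩ ≤ θ'N`).

* `SkelWindow / SkelTail / SkelConcl` : the three clauses of the crux with the occupation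
  `⟨φ'_k, γ_Ψ φ'_k⟩` replaced by an opaque family `F ε ρ N Ψ k`; `Skeleton` = window → tail → conclusion
  for every `v` and `F`; `becDepletionSplit_iff_skelAtOcc` : the crux IS, by `Iff.rfl`, the skeleton's
  three clauses at `F := occFamily` guarded by `IsRepulsiveFiniteRange v`; `skelAtOcc_of_skeleton` :
  the skeleton gives those clauses for EVERY `v` — `IsRepulsiveFiniteRange v` is never used (decorative).
* `becDepletionSplitSkel_false_without_tail` : the skeleton with the TAIL hypothesis dropped is FALSE
  (witness `v = 0`, family `⊤` on the modes with `‖k‖ > L_N²`, beyond every window `K√ρ·L_N`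
  eventually; near-minimisers of the free Dirichlet gas exist since `E₀(0,N,L) < ⊤`).
* `becDepletionSplitSkel_false_without_window` : the skeleton with the WINDOW hypothesis dropped is
  FALSE (witness `v = 0`, mass `N` on the single mode `k = (1,1,1)`, inside every window eventually).
* `not_naiveThresholdRecipe` : the item text's recipe `η = (1−θ)/2`, `θ' = max (1/2) ((1+θ)/2)` is
  FALSE in the corner `θ < 0` (witness `θ = -1`); the clip `θ⁺ = max θ 0` repairs it.
* `threshold_tight`, `not_thresholdCombine_sameTheta` : no conclusion threshold `θ' < η + θ⁺` is
  possible; in particular `θ' = θ` (the tail's own constant) fails for every `θ < 1`.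

At the concrete level (`F = ⟨φ'_k, γ_Ψ φ'_k⟩`) neither `_false_without_` statement is decidable today —
each would need total inner-box depletion of Dirichlet near-minimisers for an admissible `v` at
arbitrarily small density — so the skeleton level is where the load-bearing structure is recorded.
-/

noncomputable section

open Filter
open scoped ENNReal NNReal BigOperators Classical

namespace Summit.AtomisticToContinuum.BoseEinsteinCondensation.Theorems.BecDepletionSplit.Negative

open Literature.MathematicalPhysics.QuantumManyBody.BoseGas
open Summit.AtomisticToContinuum.BoseEinsteinCondensation.Theses.BECInfraredBound (BecDepletionSplit)

/-! ## The occupation-generic skeleton of the crux -/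

/-- An opaque "occupation family": `F ε ρ N Ψ k` stands for `⟨φ'_k, γ_Ψ φ'_k⟩` (inner box of
parameter `ε`, side `L = sideLength ρ N`). Route-local scaffolding (deliberately untagged: not a
literature fact). -/
abbrev Family : Type :=
  (ε ρ : ℝ) → (N : ℕ) → TrialState N (sideLength ρ N) → (Fin 3 → ℤ) → ℝ≥0∞

/-- WINDOW clause of the crux for an opaque family (verbatim the first hypothesis of
`BecDepletionSplit` with the occupation replaced by `F ε ρ N Ψ k`). Route-local (untagged). -/
def SkelWindow (v : ℝ → ℝ≥0∞) (F : Family) : Prop :=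
  ∀ ε : ℝ, 0 < ε → ε < 1 / 4 → ∀ K : ℝ, 0 < K → ∀ η : ℝ, 0 < η → ∃ ρ₀ : ℝ, 0 < ρ₀ ∧
    ∀ ρ : ℝ, 0 < ρ → ρ < ρ₀ → ∀ᶠ N : ℕ in atTop, ∃ δ : ℝ≥0∞, 0 < δ ∧
      ∀ Ψ : TrialState N (sideLength ρ N),
        energy v Ψ ≤ groundStateEnergy v N (sideLength ρ N) + δ →
          ∑' k : {k : Fin 3 → ℤ // k ≠ 0 ∧ ‖(fun j => (k j : ℝ))‖ ≤ K * Real.sqrt ρ * sideLength ρ N},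
              F ε ρ N Ψ k.1 ≤ ENNReal.ofReal (η * N)

/-- TAIL clause of the crux for an opaque family (verbatim the second hypothesis). Route-local
(untagged). -/
def SkelTail (v : ℝ → ℝ≥0∞) (F : Family) : Prop :=
  ∃ K : ℝ, 0 < K ∧ ∃ θ : ℝ, θ < 1 ∧ ∀ ε : ℝ, 0 < ε → ε < 1 / 4 → ∃ ρ₀ : ℝ, 0 < ρ₀ ∧
    ∀ ρ : ℝ, 0 < ρ → ρ < ρ₀ → ∀ᶠ N : ℕ in atTop, ∃ δ : ℝ≥0∞, 0 < δ ∧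
      ∀ Ψ : TrialState N (sideLength ρ N),
        energy v Ψ ≤ groundStateEnergy v N (sideLength ρ N) + δ →
          ∑' k : {k : Fin 3 → ℤ // K * Real.sqrt ρ * sideLength ρ N < ‖(fun j => (k j : ℝ))‖},
              F ε ρ N Ψ k.1 ≤ ENNReal.ofReal (θ * N)

/-- CONCLUSION clause of the crux for an opaque family (verbatim the conclusion). Route-local
(untagged). -/
def SkelConcl (v : ℝ → ℝ≥0∞) (F : Family) : Prop :=
  ∃ θ : ℝ, θ < 1 ∧ ∀ ε : ℝ, 0 < ε → ε < 1 / 4 → ∃ ρ₀ : ℝ, 0 < ρ₀ ∧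
    ∀ ρ : ℝ, 0 < ρ → ρ < ρ₀ → ∀ᶠ N : ℕ in atTop, ∃ δ : ℝ≥0∞, 0 < δ ∧
      ∀ Ψ : TrialState N (sideLength ρ N),
        energy v Ψ ≤ groundStateEnergy v N (sideLength ρ N) + δ →
          ∑' k : {k : Fin 3 → ℤ // k ≠ 0}, F ε ρ N Ψ k.1 ≤ ENNReal.ofReal (θ * N)

/-- The crux's own family: occupations of the inner-box plane waves `φ'_k` (verbatim the mode of
the route decl; informal source LSSY2005 Ch. 11 (11.26)–(11.27)). Route-local (untagged). -/
def occFamily : Family := fun ε ρ N Ψ k =>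
  occupation N
    ({x : EuclideanSpace ℝ (Fin 3) |
        ∀ j, x j ∈ Set.Ioo (ε * sideLength ρ N) (sideLength ρ N - ε * sideLength ρ N)}.indicator
      fun x => ((Real.sqrt (((1 - 2 * ε) * sideLength ρ N) ^ 3))⁻¹ : ℂ) *
        Complex.exp (Complex.I * ↑(2 * Real.pi / ((1 - 2 * ε) * sideLength ρ N) *
          ∑ j, (k j : ℝ) * x j)))
    Ψ.ψ

/-- The occupation-generic SKELETON of the crux (= the transfer `C⁺ = depletionSplit_filter` of the
nearmin-filter card, PROVED there for every `v` and `F`). A variant STATEMENT of this file — not a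
literature fact; deliberately untagged so that it is not relocated. -/
def Skeleton : Prop :=
  ∀ v : ℝ → ℝ≥0∞, ∀ F : Family, SkelWindow v F → SkelTail v F → SkelConcl v F

/-- FAITHFULNESS: the crux is LITERALLY (`Iff.rfl`) the three skeleton clauses at the crux's own
family `occFamily`, guarded by `IsRepulsiveFiniteRange v`. [folklore] -/
theorem becDepletionSplit_iff_skelAtOcc :
    BecDepletionSplit ↔ ∀ v : ℝ → ℝ≥0∞, IsRepulsiveFiniteRange v →
      SkelWindow v occFamily → SkelTail v occFamily → SkelConcl v occFamily :=
  Iff.rfl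

/-- Finding 1: the skeleton yields the crux's clauses at `occFamily` for EVERY `v` — the hypothesis
`IsRepulsiveFiniteRange v` is never used (decorative at the skeleton level). [folklore] -/
theorem skelAtOcc_of_skeleton (h : Skeleton) (v : ℝ → ℝ≥0∞) :
    SkelWindow v occFamily → SkelTail v occFamily → SkelConcl v occFamily :=
  h v occFamily

/-! ## Load-bearing analysis (findings 2 and 3) -/

/-- The crux skeleton with the TAIL hypothesis dropped. A variant STATEMENT of this file, refuted below —
not a literature fact; deliberately untagged so that it is not relocated. -/
def BecDepletionSplitSkelWithoutTail : Prop :=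
  ∀ v : ℝ → ℝ≥0∞, IsRepulsiveFiniteRange v → ∀ F : Family, SkelWindow v F → SkelConcl v F

/-- The crux skeleton with the WINDOW hypothesis dropped. A variant STATEMENT of this file, refuted below
— not a literature fact; deliberately untagged so that it is not relocated. -/
def BecDepletionSplitSkelWithoutWindow : Prop :=
  ∀ v : ℝ → ℝ≥0∞, IsRepulsiveFiniteRange v → ∀ F : Family, SkelTail v F → SkelConcl v F

/-- Near-minimisers of the FREE Dirichlet gas exist in every thermodynamic box (`E₀ < ⊤`), so a
near-minimiser clause with a false body is false — the engine of both witnesses. [folklore] -/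
theorem exists_nearMin_zero {ρ : ℝ} (hρ : 0 < ρ) {N : ℕ} (hN : 0 < N) {δ : ℝ≥0∞} (hδ : 0 < δ) :
    ∃ Ψ : TrialState N (sideLength ρ N),
      energy 0 Ψ ≤ groundStateEnergy 0 N (sideLength ρ N) + δ := by
  have hL : 0 < sideLength ρ N := sideLength_pos_of_pos hρ hN
  have htop : groundStateEnergy (0 : ℝ → ℝ≥0∞) N (sideLength ρ N) < ⊤ :=
    groundStateEnergy_lt_top_of_lintegral_ne_top' measurable_const (by simp) hL hN
  obtain ⟨Ψ, hΨ⟩ := iInf_lt_iff.mp (ENNReal.lt_add_right htop.ne hδ.ne')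
  exact ⟨Ψ, hΨ.le⟩

/-- Witness family for finding 3: mass `⊤` on every mode beyond `L_N²`, `0` elsewhere. Route-local
(untagged). -/
def farTopFamily : Family := fun _ ρ N _ k =>
  if sideLength ρ N ^ 2 < ‖(fun j => (k j : ℝ))‖ then ⊤ else 0

/-- Witness family for finding 2: mass `N` on the single inner mode `k = (1,1,1)`. Route-local
(untagged). -/
def oneModeFamily : Family := fun _ _ N _ k =>
  if k = (fun _ => (1 : ℤ)) then (N : ℝ≥0∞) else 0

/-- **Finding 3: the TAIL hypothesis is load-bearing** — without it the occupation-generic crux is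
false (witness `v = 0`, `farTopFamily`). [folklore] -/
theorem becDepletionSplitSkel_false_without_tail : ¬ BecDepletionSplitSkelWithoutTail := by
  intro h
  have hW : SkelWindow 0 farTopFamily := by
    intro ε _ _ K hK η _
    refine ⟨1, one_pos, fun ρ hρ _ => ?_⟩
    filter_upwards [(tendsto_sideLength_atTop hρ).eventually_ge_atTop (K * Real.sqrt ρ)] with N hN
    refine ⟨1, one_pos, fun Ψ _ => ?_⟩
    have hL0 : 0 ≤ sideLength ρ N := le_trans (by positivity) hN
    have hzero : ∀ k : {k : Fin 3 → ℤ //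
        k ≠ 0 ∧ ‖(fun j => (k j : ℝ))‖ ≤ K * Real.sqrt ρ * sideLength ρ N},
        farTopFamily ε ρ N Ψ k.1 = 0 := by
      intro k
      simp only [farTopFamily]
      rw [if_neg]
      push Not
      calc ‖(fun j => (k.1 j : ℝ))‖ ≤ K * Real.sqrt ρ * sideLength ρ N := k.2.2
        _ ≤ sideLength ρ N * sideLength ρ N := mul_le_mul_of_nonneg_right hN hL0
        _ = sideLength ρ N ^ 2 := (sq _).symm
    rw [ENNReal.tsum_eq_zero.2 hzero]
    exact zero_le
  obtain ⟨θ, _, hC⟩ := h 0 ⟨measurable_const, 0, fun _ _ => rfl⟩ farTopFamily hW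
  obtain ⟨ρ₀, hρ₀, hC'⟩ := hC (1 / 8) (by norm_num) (by norm_num)
  have hρ : (0 : ℝ) < ρ₀ / 2 := by positivity
  obtain ⟨N, hN1, δ, hδ, hΨ⟩ :=
    ((eventually_ge_atTop 1).and (hC' (ρ₀ / 2) hρ (by linarith))).exists
  obtain ⟨Ψ, hΨE⟩ := exists_nearMin_zero hρ (N := N) (by omega) hδ
  have hle := hΨ Ψ hΨE
  -- a lattice mode beyond `L²`
  obtain ⟨n, hn⟩ := exists_nat_gt (sideLength (ρ₀ / 2) N ^ 2)
  set e : Fin 3 → ℤ := fun _ => (n : ℤ) + 1 with he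
  have he0 : e ≠ 0 := by
    intro h0
    have := congr_fun h0 0
    simp [he] at this
    omega
  have hf0 : (fun j => (e j : ℝ)) 0 = (n : ℝ) + 1 := by simp [he]
  have hnorm : sideLength (ρ₀ / 2) N ^ 2 < ‖(fun j => (e j : ℝ))‖ := by
    calc sideLength (ρ₀ / 2) N ^ 2 < (n : ℝ) + 1 := by linarith
      _ = ‖(fun j => (e j : ℝ)) 0‖ := by rw [hf0, Real.norm_of_nonneg (by positivity)]
      _ ≤ ‖(fun j => (e j : ℝ))‖ := norm_le_pi_norm (fun j => (e j : ℝ)) (0 : Fin 3)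
  have htop : farTopFamily (1 / 8) (ρ₀ / 2) N Ψ e = ⊤ := by
    simp only [farTopFamily]
    rw [if_pos hnorm]
  have hge : (⊤ : ℝ≥0∞) ≤ ∑' k : {k : Fin 3 → ℤ // k ≠ 0}, farTopFamily (1 / 8) (ρ₀ / 2) N Ψ k.1 :=
    calc (⊤ : ℝ≥0∞) = farTopFamily (1 / 8) (ρ₀ / 2) N Ψ e := htop.symm
      _ ≤ _ := ENNReal.le_tsum (⟨e, he0⟩ : {k : Fin 3 → ℤ // k ≠ 0})
  exact lt_irrefl (⊤ : ℝ≥0∞) ((hge.trans hle).trans_lt ENNReal.ofReal_lt_top)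

/-- **Finding 2: the WINDOW hypothesis is load-bearing** — without it the occupation-generic crux
is false (witness `v = 0`, `oneModeFamily`). [folklore] -/
theorem becDepletionSplitSkel_false_without_window : ¬ BecDepletionSplitSkelWithoutWindow := by
  intro h
  have hT : SkelTail 0 oneModeFamily := by
    refine ⟨1, one_pos, 0, zero_lt_one, fun ε _ _ => ⟨1, one_pos, fun ρ hρ _ => ?_⟩⟩
    filter_upwards [(tendsto_sideLength_atTop hρ).eventually_ge_atTop (1 / Real.sqrt ρ)] with N hN
    refine ⟨1, one_pos, fun Ψ _ => ?_⟩
    have hs : 0 < Real.sqrt ρ := Real.sqrt_pos.2 hρ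
    have hsq : (1 : ℝ) ≤ 1 * Real.sqrt ρ * sideLength ρ N := by
      rw [one_mul]
      calc (1 : ℝ) = Real.sqrt ρ * (1 / Real.sqrt ρ) := by field_simp
        _ ≤ Real.sqrt ρ * sideLength ρ N := mul_le_mul_of_nonneg_left hN hs.le
    have hzero : ∀ k : {k : Fin 3 → ℤ //
        1 * Real.sqrt ρ * sideLength ρ N < ‖(fun j => (k j : ℝ))‖},
        oneModeFamily ε ρ N Ψ k.1 = 0 := by
      intro k
      simp only [oneModeFamily]
      rw [if_neg]
      intro hk
      have hle1 : ‖(fun j => (k.1 j : ℝ))‖ ≤ 1 := by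
        refine (pi_norm_le_iff_of_nonneg zero_le_one).2 fun j => ?_
        rw [hk]
        simp
      linarith [k.2]
    rw [ENNReal.tsum_eq_zero.2 hzero]
    exact zero_le
  obtain ⟨θ, hθ, hC⟩ := h 0 ⟨measurable_const, 0, fun _ _ => rfl⟩ oneModeFamily hT
  obtain ⟨ρ₀, hρ₀, hC'⟩ := hC (1 / 8) (by norm_num) (by norm_num)
  have hρ : (0 : ℝ) < ρ₀ / 2 := by positivity
  obtain ⟨N, hN1, δ, hδ, hΨ⟩ :=
    ((eventually_ge_atTop 1).and (hC' (ρ₀ / 2) hρ (by linarith))).exists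
  obtain ⟨Ψ, hΨE⟩ := exists_nearMin_zero hρ (N := N) (by omega) hδ
  have hle := hΨ Ψ hΨE
  have he0 : (fun _ : Fin 3 => (1 : ℤ)) ≠ 0 := by
    intro h0
    have := congr_fun h0 0
    simp at this
  have hge : (N : ℝ≥0∞) ≤ ∑' k : {k : Fin 3 → ℤ // k ≠ 0}, oneModeFamily (1 / 8) (ρ₀ / 2) N Ψ k.1 :=
    calc (N : ℝ≥0∞) = oneModeFamily (1 / 8) (ρ₀ / 2) N Ψ (fun _ => (1 : ℤ)) := by
          simp [oneModeFamily]
      _ ≤ _ := ENNReal.le_tsum (⟨fun _ => (1 : ℤ), he0⟩ : {k : Fin 3 → ℤ // k ≠ 0})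
  have hN' : (0 : ℝ) < N := by exact_mod_cast hN1
  have hlt : ENNReal.ofReal (θ * N) < (N : ℝ≥0∞) := by
    rw [← ENNReal.ofReal_natCast N, ENNReal.ofReal_lt_ofReal_iff hN']
    nlinarith
  exact lt_irrefl _ ((hge.trans hle).trans_lt hlt)

/-! ## The item text's recipe and the tightness of the threshold step (findings 4 and 5) -/

/-- **Finding 4: the naive recipe of the item text is false** (`η = (1−θ)/2`,
`θ' = max (1/2) ((1+θ)/2)`): at `θ = -1` it asks `1 + 0 ≤ 1/2`. [folklore] -/
theorem not_naiveThresholdRecipe :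
    ¬ ∀ θ : ℝ, θ < 1 → ∀ (N : ℕ) (a b : ℝ≥0∞), a ≤ ENNReal.ofReal ((1 - θ) / 2 * N) →
        b ≤ ENNReal.ofReal (θ * N) → a + b ≤ ENNReal.ofReal (max (1 / 2) ((1 + θ) / 2) * N) := by
  intro h
  have h1 : (1 : ℝ≥0∞) ≤ ENNReal.ofReal ((1 - (-1 : ℝ)) / 2 * (1 : ℕ)) := by norm_num
  have := h (-1) (by norm_num) 1 1 0 h1 zero_le
  have hmax : max (1 / 2 : ℝ) ((1 + (-1 : ℝ)) / 2) = 1 / 2 := by norm_num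
  rw [hmax, add_zero, Nat.cast_one, mul_one] at this
  have h2 : ENNReal.ofReal (1 / 2 : ℝ) < 1 := by
    rw [← ENNReal.ofReal_one, ENNReal.ofReal_lt_ofReal_iff one_pos]
    norm_num
  exact lt_irrefl _ (this.trans_lt h2)

/-- **Finding 5 (tightness of the threshold step)**: with a positive window share `η` and a tail
share `θ ≥ 0`, no conclusion threshold `θ' < η + θ` works — at `N = 1`, `a = ofReal η`,
`b = ofReal θ` the sum is `ofReal (η + θ)`. [folklore] -/
theorem threshold_tight (θ η θ' : ℝ) (hθ : 0 ≤ θ) (hη : 0 < η) (hlt : θ' < η + θ) :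
    ¬ ∀ (N : ℕ) (a b : ℝ≥0∞), a ≤ ENNReal.ofReal (η * N) → b ≤ ENNReal.ofReal (θ * N) →
        a + b ≤ ENNReal.ofReal (θ' * N) := by
  intro h
  have := h 1 (ENNReal.ofReal η) (ENNReal.ofReal θ) (by simp) (by simp)
  rw [← ENNReal.ofReal_add hη.le hθ, Nat.cast_one, mul_one, ENNReal.ofReal_le_ofReal_iff'] at this
  rcases this with h1 | h2 <;> linarith

/-- **Finding 5, corollary: the natural strengthening "`θ' =` the tail's `θ`" is false** for every
`θ < 1` and every window share `η > 0`. [folklore] -/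
theorem not_thresholdCombine_sameTheta (θ : ℝ) (_hθ : θ < 1) (η : ℝ) (hη : 0 < η) :
    ¬ ∀ (N : ℕ) (a b : ℝ≥0∞), a ≤ ENNReal.ofReal (η * N) → b ≤ ENNReal.ofReal (θ * N) →
        a + b ≤ ENNReal.ofReal (θ * N) := by
  rcases le_or_gt 0 θ with hθ0 | hθ0
  · exact threshold_tight θ η θ hθ0 hη (by linarith)
  · intro h
    have := h 1 (ENNReal.ofReal η) 0 (by simp) zero_le
    rw [add_zero, Nat.cast_one, mul_one, ENNReal.ofReal_of_nonpos hθ0.le,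
      nonpos_iff_eq_zero, ENNReal.ofReal_eq_zero] at this
    linarith

end Summit.AtomisticToContinuum.BoseEinsteinCondensation.Theorems.BecDepletionSplit.Negative

end
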